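import Mathlib
import HarnessLib

/-!
# Generalized (`{1}`-) inverses and the solution of linear systems (Penrose; Ben-Israel–Greville)

A `{1}`-inverse (inner inverse, generalized inverse) of a matrix `A` is any matrix `G` with
`A * G * A = A`.  Penrose [Penrose1955] showed that `{1}`-inverses solve linear matrix equations
exactly as ordinary inverses do in the nonsingular case; we formalise the results of
Ben-Israel–Greville, *Generalized Inverses*, Ch. 2 §§1–2 [BenIsraelGreville2003] and the formula
of Urquhart (Ch. 1 §5 Thm 4), over an arbitrary ring `R` (a `StarRing` where adjoints occur):

* `exists_solution_iff` (Ch. 2 §1 **Thm 1**, Penrose): for `{1}`-inverses `G` of `A` and `H` of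
  `B`, the equation `A X B = D` is consistent iff `A G D H B = D`, and then
  `solution_iff_exists`: `X` solves it iff `X = G D H + Y - G A Y B H` for some `Y`;
* `exists_common_solution_iff`, `common_solution_iff_exists` (Ch. 2 §1 **Ex. 4–5**, Penrose):
  `A X = B`, `X D = E` have a common solution iff each is consistent and `A E = B D`; the common
  solutions are `X₀ + (1 - G A) Y (1 - D H)`;
* `oneInverse_iff_exists` (Ch. 2 §1 **Cor. 1**, Bjerhammar): the set `A{1}` is
  `{G + Z - G A Z A G}`;
* `exists_mulVec_eq_iff`, `mulVec_eq_iff_exists` (Ch. 2 §1 **Cor. 2**): `A x = b` is consistent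
  iff `A (G b) = b`, with general solution `x = G b + (1 - G A) y`;
* `mul_oneInverse_idem`, `oneInverse_conj`, `conjTranspose_oneInverse`, `oneInverse_eq_inv`,
  `rank_le_rank_oneInverse`, `rank_mul_oneInverse` (Ch. 1 §3 **Lemma 1** (a), (b), (d)–(f));
* `oneInverse_iff_forall_mulVec` (Ch. 2 §1 **Thm 2**, Bose): `G ∈ A{1}` iff `x = G b` solves
  every consistent system `A x = b`;
* `isOneThreeInverse_iff`, `isOneThreeInverse_iff_exists` (Ch. 2 §2 **Thm 3**, **Cor. 3**) and
  `isOneFourInverse_iff`, `isOneFourInverse_iff_exists` (Ch. 2 §2 **Thm 4**, **Cor. 4**): the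
  `{1,3}`-inverses of `A` are the solutions of `A X = A K` (`K` any `{1,3}`-inverse), i.e.
  `K + (1 - K A) Z`; dually for `{1,4}`-inverses;
* `penroseEquations_of_oneFour_mul_oneThree` (Ch. 1 §5 **Thm 4**, Urquhart):
  `A⁽¹’⁴⁾ A A⁽¹’³⁾` satisfies all four Penrose equations, i.e. it is the Moore–Penrose inverse.

Everything is proved; there are no named facts.  The hypotheses are stated as raw equations
(`A * G * A = A`, `(A * K)ᴴ = A * K`, …) so that the lemmas apply to any generalized inverse at hand.
-/

open Matrix

namespace Literature.LinearAlgebra.Matrix.GeneralizedInverse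

variable {R : Type*} [Ring R]
variable {m n p q : Type*} [Fintype m] [Fintype n] [Fintype p] [Fintype q]

/-! ### The matrix equation `A X B = D` (Penrose) -/

section MatrixEquation

variable {A : Matrix m n R} {G : Matrix n m R} {B : Matrix p q R} {H : Matrix q p R}
  {D : Matrix m q R}

/-- Necessity of Penrose's criterion: if `A X B = D` has a solution then `A G D H B = D` for ALL
`{1}`-inverses `G` of `A` and `H` of `B`. [cite: BenIsraelGreville2003, Ch. 2 §1 Thm 1 (proof)] -/
theorem criterion_of_solution (hG : A * G * A = A) (hH : B * H * B = B) {X : Matrix n p R}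
    (hX : A * X * B = D) : A * G * D * H * B = D := by
  rw [← hX]
  calc A * G * (A * X * B) * H * B = (A * G * A) * X * (B * H * B) := by
        simp only [Matrix.mul_assoc]
    _ = A * X * B := by rw [hG, hH]

/-- Sufficiency of Penrose's criterion: if `A G D H B = D` then `X = G D H` solves `A X B = D`.
[cite: BenIsraelGreville2003, Ch. 2 §1 Thm 1 (proof)] -/
theorem solution_of_criterion (hD : A * G * D * H * B = D) : A * (G * D * H) * B = D := by
  simpa only [Matrix.mul_assoc] using hD

/-- **Penrose's theorem** (Ben-Israel–Greville Ch. 2 Thm 1): for `{1}`-inverses `G` of `A` and `H`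
of `B`, the matrix equation `A X B = D` is consistent if and only if `A G D H B = D`.
[cite: BenIsraelGreville2003, Ch. 2 §1 Thm 1 eq. (2)] -/
theorem exists_solution_iff (hG : A * G * A = A) (hH : B * H * B = B) :
    (∃ X : Matrix n p R, A * X * B = D) ↔ A * G * D * H * B = D :=
  ⟨fun ⟨_, hX⟩ => criterion_of_solution hG hH hX, fun hD => ⟨G * D * H, solution_of_criterion hD⟩⟩

/-- **The general solution** of a consistent equation `A X B = D`:
`X = G D H + Y - G A Y B H`, `Y` arbitrary. [cite: BenIsraelGreville2003, Ch. 2 §1 Thm 1 eq. (3)] -/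
theorem solution_iff_exists (hG : A * G * A = A) (hH : B * H * B = B)
    (hD : A * G * D * H * B = D) {X : Matrix n p R} :
    A * X * B = D ↔ ∃ Y : Matrix n p R, X = G * D * H + Y - G * A * Y * B * H := by
  constructor
  · intro hX
    refine ⟨X, ?_⟩
    have h : G * A * X * B * H = G * D * H := by
      rw [← hX]; simp only [Matrix.mul_assoc]
    rw [h]; abel
  · rintro ⟨Y, rfl⟩
    have h1 : A * (G * D * H) * B = D := solution_of_criterion hD
    have h2 : A * (G * A * Y * B * H) * B = A * Y * B := by
      calc A * (G * A * Y * B * H) * B = (A * G * A) * Y * (B * H * B) := by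
            simp only [Matrix.mul_assoc]
        _ = A * Y * B := by rw [hG, hH]
    rw [Matrix.mul_sub, Matrix.mul_add, Matrix.sub_mul, Matrix.add_mul, h1, h2]
    abel

end MatrixEquation

/-! ### Common solutions of `A X = B`, `X D = E` (Penrose) -/

section CommonSolution

variable {A : Matrix m n R} {G : Matrix n m R} {D : Matrix p q R} {H : Matrix q p R}
  {B : Matrix m p R} {E : Matrix n q R}

/-- **Penrose's common-solution theorem** (Ben-Israel–Greville Ch. 2 Ex. 4): the equations
`A X = B` and `X D = E` have a common solution iff each is consistent (`A G B = B`, `E H D = E`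
for `{1}`-inverses `G` of `A`, `H` of `D`) and `A E = B D`; the common solution exhibited is
`X = G B + E H - G A E H`. [cite: BenIsraelGreville2003, Ch. 2 §1 Ex. 4 (Penrose)] -/
theorem exists_common_solution_iff (hG : A * G * A = A) (hH : D * H * D = D) :
    (∃ X : Matrix n p R, A * X = B ∧ X * D = E) ↔
      (A * (G * B) = B ∧ E * H * D = E ∧ A * E = B * D) := by
  constructor
  · rintro ⟨X, hXB, hXE⟩
    refine ⟨?_, ?_, ?_⟩
    · rw [← hXB, ← Matrix.mul_assoc, ← Matrix.mul_assoc, hG]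
    · rw [← hXE, Matrix.mul_assoc, Matrix.mul_assoc, ← Matrix.mul_assoc D H D, hH]
    · rw [← hXB, ← hXE, Matrix.mul_assoc]
  · rintro ⟨hB, hE, hAE⟩
    refine ⟨G * B + E * H - G * A * E * H, ?_, ?_⟩
    · have h1 : A * (G * A * E * H) = A * E * H := by
        rw [← Matrix.mul_assoc, ← Matrix.mul_assoc, ← Matrix.mul_assoc, hG]
      rw [Matrix.mul_sub, Matrix.mul_add, hB, h1, ← Matrix.mul_assoc]
      abel
    · have h2 : G * A * E * H * D = G * B * D := by
        rw [Matrix.mul_assoc (G * A) E H, Matrix.mul_assoc (G * A) (E * H) D, hE,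
          Matrix.mul_assoc G A E, hAE, ← Matrix.mul_assoc]
      rw [Matrix.sub_mul, Matrix.add_mul, hE, h2]
      abel

/-- **General common solution** (Ben-Israel–Greville Ch. 2 Ex. 5): if `X₀` solves both `A X = B`
and `X D = E`, then the common solutions are exactly `X₀ + (1 - G A) Y (1 - D H)`, `Y` arbitrary.
[cite: BenIsraelGreville2003, Ch. 2 §1 Ex. 5 eq. (15)] -/
theorem common_solution_iff_exists [DecidableEq n] [DecidableEq p] (hG : A * G * A = A)
    (hH : D * H * D = D) {X₀ : Matrix n p R} (h₀B : A * X₀ = B) (h₀E : X₀ * D = E)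
    {X : Matrix n p R} :
    (A * X = B ∧ X * D = E) ↔ ∃ Y : Matrix n p R, X = X₀ + (1 - G * A) * Y * (1 - D * H) := by
  have hA0 : A * (1 - G * A) = 0 := by
    rw [Matrix.mul_sub, Matrix.mul_one, ← Matrix.mul_assoc, hG, sub_self]
  have hD0 : (1 - D * H) * D = 0 := by
    rw [Matrix.sub_mul, Matrix.one_mul, Matrix.mul_assoc, sub_eq_zero]
    calc D = D * H * D := hH.symm
      _ = D * (H * D) := Matrix.mul_assoc _ _ _
  constructor
  · rintro ⟨hXB, hXE⟩
    refine ⟨X - X₀, ?_⟩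
    have hAY : A * (X - X₀) = 0 := by rw [Matrix.mul_sub, hXB, h₀B, sub_self]
    have hYD : (X - X₀) * D = 0 := by rw [Matrix.sub_mul, hXE, h₀E, sub_self]
    have h1 : (1 - G * A) * (X - X₀) = X - X₀ := by
      rw [Matrix.sub_mul, Matrix.one_mul, Matrix.mul_assoc, hAY, Matrix.mul_zero, sub_zero]
    have h2 : (X - X₀) * (1 - D * H) = X - X₀ := by
      rw [Matrix.mul_sub, Matrix.mul_one, ← Matrix.mul_assoc, hYD, Matrix.zero_mul, sub_zero]
    rw [h1, h2]
    abel
  · rintro ⟨Y, rfl⟩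
    constructor
    · rw [Matrix.mul_add, h₀B, Matrix.mul_assoc (1 - G * A) Y (1 - D * H), ← Matrix.mul_assoc A,
        hA0, Matrix.zero_mul, add_zero]
    · rw [Matrix.add_mul, h₀E, Matrix.mul_assoc, hD0, Matrix.mul_zero, add_zero]

end CommonSolution

/-! ### The set `A{1}` (Bjerhammar) -/

section OneInverses

variable {A : Matrix m n R} {G : Matrix n m R}

/-- **Bjerhammar's characterisation of `A{1}`**: given one `{1}`-inverse `G`, a matrix `X` is a
`{1}`-inverse of `A` iff `X = G + Z - G A Z A G` for some `Z`.
[cite: BenIsraelGreville2003, Ch. 2 §1 Cor. 1 eq. (4)] -/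
theorem oneInverse_iff_exists (hG : A * G * A = A) {X : Matrix n m R} :
    A * X * A = A ↔ ∃ Z : Matrix n m R, X = G + Z - G * A * Z * A * G := by
  have hD : A * G * A * G * A = A := by rw [hG, hG]
  rw [solution_iff_exists hG hG hD]
  constructor
  · rintro ⟨Y, rfl⟩
    refine ⟨Y - G, ?_⟩
    have h : G * A * (Y - G) * A * G = G * A * Y * A * G - G * A * G * A * G := by
      simp only [Matrix.mul_sub, Matrix.sub_mul]
    rw [h]
    have h' : G * A * G * A * G = G * (A * G * A) * G := by simp only [Matrix.mul_assoc]
    rw [h', hG]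
    abel
  · rintro ⟨Z, rfl⟩
    refine ⟨Z + G, ?_⟩
    have h : G * A * (Z + G) * A * G = G * A * Z * A * G + G * A * G * A * G := by
      simp only [Matrix.mul_add, Matrix.add_mul]
    rw [h]
    have h' : G * A * G * A * G = G * (A * G * A) * G := by simp only [Matrix.mul_assoc]
    rw [h', hG]
    abel

/-- `A G` is idempotent for a `{1}`-inverse `G`. [cite: BenIsraelGreville2003, Ch. 1 §3 Lemma 1(f)] -/
theorem mul_oneInverse_idem (hG : A * G * A = A) : A * G * (A * G) = A * G := by
  rw [← Matrix.mul_assoc, hG]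

/-- `G A` is idempotent for a `{1}`-inverse `G`. [cite: BenIsraelGreville2003, Ch. 1 §3 Lemma 1(f)] -/
theorem oneInverse_mul_idem (hG : A * G * A = A) : G * A * (G * A) = G * A := by
  rw [Matrix.mul_assoc, ← Matrix.mul_assoc A G A, hG]

/-- Equivalence invariance: if `S`, `T` are invertible then `T⁻¹ G S⁻¹` is a `{1}`-inverse of
`S A T` (stated with explicit two-sided inverses `S'`, `T'`).
[cite: BenIsraelGreville2003, Ch. 1 §3 Lemma 1(e)] -/
theorem oneInverse_conj (hG : A * G * A = A) {S S' : Matrix m m R} {T T' : Matrix n n R}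
    [DecidableEq m] [DecidableEq n] (hS : S' * S = 1) (hT : T * T' = 1) :
    (S * A * T) * (T' * G * S') * (S * A * T) = S * A * T := by
  calc (S * A * T) * (T' * G * S') * (S * A * T)
        = S * A * (T * T') * G * (S' * S) * A * T := by simp only [Matrix.mul_assoc]
    _ = S * A * T := by rw [hS, hT, Matrix.mul_one, Matrix.mul_one, Matrix.mul_assoc S A G,
        Matrix.mul_assoc S (A * G) A, hG]

/-- The transpose-star of a `{1}`-inverse is a `{1}`-inverse of the conjugate transpose.
[cite: BenIsraelGreville2003, Ch. 1 §3 Lemma 1(a)] -/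
theorem conjTranspose_oneInverse {R : Type*} [Ring R] [StarRing R] {A : Matrix m n R}
    {G : Matrix n m R} (hG : A * G * A = A) : Aᴴ * Gᴴ * Aᴴ = Aᴴ := by
  have h := congrArg Matrix.conjTranspose hG
  rw [conjTranspose_mul, conjTranspose_mul] at h
  rw [← Matrix.mul_assoc] at h
  exact h

end OneInverses

/-! ### Over a commutative ring: the nonsingular case and ranks -/

section Comm

variable {R : Type*} [CommRing R] {A : Matrix m n R} {G : Matrix n m R}

/-- A nonsingular matrix has the unique `{1}`-inverse `A⁻¹`.
[cite: BenIsraelGreville2003, Ch. 1 §3 Lemma 1(b)] -/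
theorem oneInverse_eq_inv [DecidableEq n] {A G : Matrix n n R} [Invertible A]
    (hG : A * G * A = A) : G = A⁻¹ := by
  have h : A⁻¹ * (A * G * A) * A⁻¹ = G := by
    rw [Matrix.mul_assoc A G A, ← Matrix.mul_assoc A⁻¹ A (G * A), Matrix.inv_mul_of_invertible,
      Matrix.one_mul, Matrix.mul_assoc, Matrix.mul_inv_of_invertible, Matrix.mul_one]
  rw [← h, hG, Matrix.inv_mul_of_invertible, Matrix.one_mul]

variable [StrongRankCondition R]

/-- `rank A⁽¹⁾ ≥ rank A`. [cite: BenIsraelGreville2003, Ch. 1 §3 Lemma 1(d)] -/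
theorem rank_le_rank_oneInverse (hG : A * G * A = A) : A.rank ≤ G.rank :=
  calc A.rank = (A * G * A).rank := by rw [hG]
    _ ≤ (A * G).rank := Matrix.rank_mul_le_left _ _
    _ ≤ G.rank := Matrix.rank_mul_le_right _ _

/-- `rank (A A⁽¹⁾) = rank A`. [cite: BenIsraelGreville2003, Ch. 1 §3 Lemma 1(f)] -/
theorem rank_mul_oneInverse (hG : A * G * A = A) : (A * G).rank = A.rank :=
  le_antisymm (Matrix.rank_mul_le_left _ _)
    (calc A.rank = (A * G * A).rank := by rw [hG]
      _ ≤ (A * G).rank := Matrix.rank_mul_le_left _ _)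

/-- `rank (A⁽¹⁾ A) = rank A`. [cite: BenIsraelGreville2003, Ch. 1 §3 Lemma 1(f)] -/
theorem rank_oneInverse_mul (hG : A * G * A = A) : (G * A).rank = A.rank :=
  le_antisymm (Matrix.rank_mul_le_right _ _)
    (calc A.rank = (A * (G * A)).rank := by rw [← Matrix.mul_assoc, hG]
      _ ≤ (G * A).rank := Matrix.rank_mul_le_right _ _)

end Comm

/-! ### Ordinary linear systems `A x = b` -/

section LinearSystems

variable {A : Matrix m n R} {G : Matrix n m R}

/-- If `A x = b` is consistent then `A (G b) = b` for every `{1}`-inverse `G`.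
[cite: BenIsraelGreville2003, Ch. 2 §1 Cor. 2 (proof)] -/
theorem mulVec_mulVec_eq_of_solution (hG : A * G * A = A) {b : m → R} {x : n → R}
    (hx : A *ᵥ x = b) : A *ᵥ (G *ᵥ b) = b := by
  rw [← hx, mulVec_mulVec, mulVec_mulVec, hG]

/-- **Consistency criterion** (Ben-Israel–Greville Ch. 2 Cor. 2): `A x = b` is consistent iff
`A G b = b`. [cite: BenIsraelGreville2003, Ch. 2 §1 Cor. 2 eq. (6)] -/
theorem exists_mulVec_eq_iff (hG : A * G * A = A) {b : m → R} :
    (∃ x : n → R, A *ᵥ x = b) ↔ A *ᵥ (G *ᵥ b) = b :=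
  ⟨fun ⟨_, hx⟩ => mulVec_mulVec_eq_of_solution hG hx, fun hb => ⟨G *ᵥ b, hb⟩⟩

/-- **General solution** of a consistent system `A x = b`: `x = G b + (1 - G A) y`, `y` arbitrary.
[cite: BenIsraelGreville2003, Ch. 2 §1 Cor. 2 eq. (7)] -/
theorem mulVec_eq_iff_exists [DecidableEq n] (hG : A * G * A = A) {b : m → R}
    (hb : A *ᵥ (G *ᵥ b) = b) {x : n → R} :
    A *ᵥ x = b ↔ ∃ y : n → R, x = G *ᵥ b + (1 - G * A) *ᵥ y := by
  constructor
  · intro hx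
    refine ⟨x, ?_⟩
    rw [Matrix.sub_mulVec, Matrix.one_mulVec, ← mulVec_mulVec, hx]
    abel
  · rintro ⟨y, rfl⟩
    have h : A *ᵥ ((1 - G * A) *ᵥ y) = 0 := by
      rw [mulVec_mulVec, Matrix.mul_sub, Matrix.mul_one, ← Matrix.mul_assoc, hG, sub_self,
        Matrix.zero_mulVec]
    rw [mulVec_add, hb, h, add_zero]

/-- **Bose's theorem** (Ben-Israel–Greville Ch. 2 Thm 2): `G` is a `{1}`-inverse of `A` iff
`x = G b` solves every consistent system `A x = b`. [cite: BenIsraelGreville2003, Ch. 2 §1 Thm 2] -/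
theorem oneInverse_iff_forall_mulVec :
    A * G * A = A ↔ ∀ b : m → R, (∃ x : n → R, A *ᵥ x = b) → A *ᵥ (G *ᵥ b) = b := by
  constructor
  · rintro hG b ⟨x, hx⟩
    exact mulVec_mulVec_eq_of_solution hG hx
  · intro h
    rw [Matrix.ext_iff_mulVec]
    intro v
    rw [← mulVec_mulVec, ← mulVec_mulVec]
    exact h (A *ᵥ v) ⟨v, rfl⟩

end LinearSystems

/-! ### `{1,3}`- and `{1,4}`-inverses; Urquhart's formula -/

section Star

variable {R : Type*} [Ring R] [StarRing R]
variable {A : Matrix m n R} {K : Matrix n m R}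

/-- **`{1,3}`-inverses** (Ben-Israel–Greville Ch. 2 Thm 3): if `K` is a `{1,3}`-inverse of `A`
(`A K A = A`, `A K` self-adjoint), then `X` is a `{1,3}`-inverse iff `A X = A K`.
[cite: BenIsraelGreville2003, Ch. 2 §2 Thm 3 eq. (16)] -/
theorem isOneThreeInverse_iff (hK : A * K * A = A) (hKh : (A * K)ᴴ = A * K) {X : Matrix n m R} :
    (A * X * A = A ∧ (A * X)ᴴ = A * X) ↔ A * X = A * K := by
  constructor
  · rintro ⟨hX, hXh⟩
    -- `A K = (A X A) K = (A X)ᴴ (A K)ᴴ = (A K A X)ᴴ = (A X)ᴴ = A X`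
    symm
    calc A * K = A * X * A * K := by rw [hX]
      _ = (A * X)ᴴ * (A * K)ᴴ := by rw [hXh, hKh, Matrix.mul_assoc]
      _ = (A * K * (A * X))ᴴ := (conjTranspose_mul _ _).symm
      _ = (A * X)ᴴ := by rw [← Matrix.mul_assoc, hK]
      _ = A * X := hXh
  · intro hX
    refine ⟨?_, ?_⟩
    · rw [hX, hK]
    · rw [hX, hKh]

/-- The set `A{1,3}` is `{K + (1 - K A) Z}` (Ben-Israel–Greville Ch. 2 Cor. 3).
[cite: BenIsraelGreville2003, Ch. 2 §2 Cor. 3 eq. (17)] -/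
theorem isOneThreeInverse_iff_exists [DecidableEq n] (hK : A * K * A = A)
    (hKh : (A * K)ᴴ = A * K) {X : Matrix n m R} :
    (A * X * A = A ∧ (A * X)ᴴ = A * X) ↔ ∃ Z : Matrix n m R, X = K + (1 - K * A) * Z := by
  rw [isOneThreeInverse_iff hK hKh]
  constructor
  · intro hX
    refine ⟨X - K, ?_⟩
    have h : K * A * X = K * A * K := by rw [Matrix.mul_assoc, hX, ← Matrix.mul_assoc]
    rw [Matrix.sub_mul, Matrix.one_mul, Matrix.mul_sub, h]
    abel
  · rintro ⟨Z, rfl⟩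
    rw [Matrix.mul_add, ← Matrix.mul_assoc, Matrix.mul_sub, Matrix.mul_one, ← Matrix.mul_assoc, hK,
      sub_self, Matrix.zero_mul, add_zero]

/-- **`{1,4}`-inverses** (Ben-Israel–Greville Ch. 2 Thm 4): if `K` is a `{1,4}`-inverse of `A`
(`A K A = A`, `K A` self-adjoint), then `X` is a `{1,4}`-inverse iff `X A = K A`.
[cite: BenIsraelGreville2003, Ch. 2 §2 Thm 4] -/
theorem isOneFourInverse_iff (hK : A * K * A = A) (hKh : (K * A)ᴴ = K * A) {X : Matrix n m R} :
    (A * X * A = A ∧ (X * A)ᴴ = X * A) ↔ X * A = K * A := by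
  constructor
  · rintro ⟨hX, hXh⟩
    -- `K A = K (A X A) = (K A)ᴴ (X A)ᴴ = (X A K A)ᴴ = (X A)ᴴ = X A`
    symm
    calc K * A = K * A * (X * A) := by
          rw [Matrix.mul_assoc K A (X * A), ← Matrix.mul_assoc A X A, hX]
      _ = (K * A)ᴴ * (X * A)ᴴ := by rw [hXh, hKh]
      _ = (X * A * (K * A))ᴴ := (conjTranspose_mul _ _).symm
      _ = (X * A)ᴴ := by rw [Matrix.mul_assoc, ← Matrix.mul_assoc A K A, hK]
      _ = X * A := hXh
  · intro hX
    refine ⟨?_, ?_⟩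
    · rw [Matrix.mul_assoc, hX, ← Matrix.mul_assoc, hK]
    · rw [hX, hKh]

/-- The set `A{1,4}` is `{K + Y (1 - A K)}` (Ben-Israel–Greville Ch. 2 Cor. 4).
[cite: BenIsraelGreville2003, Ch. 2 §2 Cor. 4] -/
theorem isOneFourInverse_iff_exists [DecidableEq m] (hK : A * K * A = A)
    (hKh : (K * A)ᴴ = K * A) {X : Matrix n m R} :
    (A * X * A = A ∧ (X * A)ᴴ = X * A) ↔ ∃ Y : Matrix n m R, X = K + Y * (1 - A * K) := by
  rw [isOneFourInverse_iff hK hKh]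
  constructor
  · intro hX
    refine ⟨X - K, ?_⟩
    have h : X * A * K = K * A * K := by rw [hX]
    rw [Matrix.mul_sub, Matrix.mul_one, Matrix.sub_mul, ← Matrix.mul_assoc, ← Matrix.mul_assoc, h]
    abel
  · rintro ⟨Y, rfl⟩
    rw [Matrix.add_mul, Matrix.mul_assoc, Matrix.sub_mul, Matrix.one_mul, hK, sub_self,
      Matrix.mul_zero, add_zero]

/-- **Urquhart's formula** (Ben-Israel–Greville Ch. 1 Thm 4): if `K` is a `{1,4}`-inverse and `L`
a `{1,3}`-inverse of `A`, then `X = K A L` satisfies all four Penrose equations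
`A X A = A`, `X A X = X`, `(A X)ᴴ = A X`, `(X A)ᴴ = X A` — so `A⁽¹’⁴⁾ A A⁽¹’³⁾ = A†`.
[cite: BenIsraelGreville2003, Ch. 1 §5 Thm 4 (Urquhart) eq. (15)] -/
theorem penroseEquations_of_oneFour_mul_oneThree {L : Matrix n m R} (hK : A * K * A = A)
    (hKh : (K * A)ᴴ = K * A) (hL : A * L * A = A) (hLh : (A * L)ᴴ = A * L) :
    A * (K * A * L) * A = A ∧ (K * A * L) * A * (K * A * L) = K * A * L ∧
      (A * (K * A * L))ᴴ = A * (K * A * L) ∧ ((K * A * L) * A)ᴴ = (K * A * L) * A := by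
  have hAX : A * (K * A * L) = A * L := by
    rw [← Matrix.mul_assoc, ← Matrix.mul_assoc, hK]
  have hXA : K * A * L * A = K * A := by
    rw [Matrix.mul_assoc, Matrix.mul_assoc, ← Matrix.mul_assoc A L A, hL]
  refine ⟨?_, ?_, ?_, ?_⟩
  · rw [hAX, hL]
  · rw [hXA]
    calc K * A * (K * A * L) = K * (A * K * A) * L := by simp only [Matrix.mul_assoc]
      _ = K * A * L := by rw [hK]
  · rw [hAX, hLh]
  · rw [hXA, hKh]

end Star

end Literature.LinearAlgebra.Matrix.GeneralizedInverse
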